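import Mathlib
import Literature.Analysis.Convex.RestartedPDHG
import HarnessLib

/-!
# Linear decay of the PDHG fixed-point residual under metric sub-regularity (Lu–Yang 2022, Thm 2)

Topic `Literature/Analysis/Convex` (companion of `PrimalDualHybridGradient.lean` — the PDHG iteration
`pdhgIter`, its metric `M_{τ,σ}`, and the residual facts `residual_antitone` (monotone) /
`residual_le_div` (`O(1/k)`) — and of `RestartedPDHG.lean` — the `M`-seminorm `normM` and the
`M`-distance to a set `infDistM`). Namespace `Literature.Analysis.Convex.PDHGResidualMetricSubregularity`.
Everything PROVED; no named facts, no `sorry`.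

Source. H. Lu, J. Yang, *On the infimal sub-differential size of primal-dual hybrid gradient method
and beyond*, arXiv:2206.12061 (2022) [LuYang2022] (fetched and read this session: §2 Algorithm 1 and
(4) `P_s(z^k − z^{k+1}) ∈ F(z^{k+1})`; §3 **Theorem 1** `dist²_{P_s⁻¹}(0, F(z^k)) ≤ ‖z⁰ − z*‖²_{P_s}/k`
(p. 9) and Proposition 1 (monotonicity); §4 **Definition 2** (metric sub-regularity w.r.t. `P_s` on `S`:
`α_s · dist_{P_s}(z, Z*) ≤ dist_{P_s⁻¹}(0, F(z))` for `z ∈ S`), Examples 1–3 (unconstrained bilinear,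
LP via Hoffman's constant, strongly-convex–strongly-concave) and **Theorem 2** (p. 12): "Suppose the
step-size `s < 1/‖A‖`, and the minimax problem satisfies metric sub-regularity condition (9) on a set
`S` that contains `{z^k}`. Then, it holds for any iteration `k ≥ ⌈e/α_s²⌉` that
`dist²_{P_s⁻¹}(0, F(z^k)) ≤ exp(1 − k/⌈e/α_s²⌉) · dist²_{P_s⁻¹}(0, F(z⁰))`", with its proof: Theorem 1
restarted at `z^{k−K}`, `K = ⌈e/α_s²⌉`, minimised over `z*`, then (9)). This is the printed linear-rate
statement for the KKT-ERROR progress metric of PDHG (the quantity cuPDLP-type solvers restart on).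

WHAT IS TYPED (general step sizes `τ, σ > 0`, `τσ‖K‖² ≤ 1`, monotone `A`, `B` with resolvent maps, as
in the tree's PDHG files; the paper's `P_s` is the tree's `M_{τ,σ}` with `τ = σ = s`):
* `msqResidual K τ σ jA jB z₀ k = ‖z^k − z^{k+1}‖²_M` — the squared `M`-norm of the CERTIFIED element
  `M(z^k − z^{k+1}) ∈ F(z^{k+1})` (so `dist²_{M⁻¹}(0, F(z^{k+1})) ≤ msqResidual k`; the tree's
  `residual_antitone` / `residual_le_div` are about this quantity);
* `pdhgIter_add` (restarting the iteration: `z^{i+n}` is the `n`-th iterate from `z^i`),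
  `msqResidual_le_normM_sq_div` ([LY22, Thm 1] restarted at `z^i`:
  `‖z^{i+n} − z^{i+n+1}‖²_M ≤ ‖z^i − z*‖²_M/(n+1)`), `msqResidual_le_infDistM_sq_div` (minimised over
  `z* ∈ Z*`);
* the sub-regularity hypothesis is stated ON THE CERTIFIED ELEMENT:
  `α² · dist_M(z^{i+1}, Z*)² ≤ ‖z^i − z^{i+1}‖²_M` for all `i` — implied by the printed (9) since
  `dist_{M⁻¹}(0, F(z^{i+1})) ≤ ‖M(z^i − z^{i+1})‖_{M⁻¹} = ‖z^i − z^{i+1}‖_M`;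
* **`msqResidual_contract`** (one epoch of `K ≥ e/α²` iterations divides the residual by `e`),
  **`msqResidual_le_exp_neg_mul`** (`‖z^{n+cK} − z^{n+cK+1}‖²_M ≤ e^{−c} ‖z^n − z^{n+1}‖²_M`) and
  **`msqResidual_le_exp`** — [LY22, THEOREM 2] in the printed shape
  `r_k ≤ exp(1 − k/K) · r_0` for all `k`, `K = ⌈e/α²⌉`.

Deviations: the infimal displacement `dist_{P⁻¹}(0, F(z))` is replaced throughout by the computable
certificate `‖z^{k} − z^{k+1}‖_M` (an upper bound for it, and what a solver evaluates); the hypothesis is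
correspondingly stated on that certificate (weaker than (9)); general `(τ, σ)` instead of `τ = σ = s`;
the examples (LP sub-regularity via Hoffman's bound — cf. `HoffmanErrorBound.lean`) are not re-derived
here. For semidefinite cone programs metric sub-regularity of the KKT operator fails generically
(cf. `SemidefiniteSharpnessFailure.lean`), so for SDP this is a conditional statement.
-/

namespace Literature.Analysis.Convex.PDHGResidualMetricSubregularity

open _root_.Filter _root_.Topology Finset
open scoped RealInnerProductSpace
open Literature.Analysis.Convex.MonotoneOperator (IsMonotone IsResolventMap zer)
open Literature.Analysis.Convex.PrimalDualHybridGradient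
open Literature.Analysis.Convex.RestartedPDHG

variable {X Y : Type*} [NormedAddCommGroup X] [InnerProductSpace ℝ X] [CompleteSpace X]
  [NormedAddCommGroup Y] [InnerProductSpace ℝ Y] [CompleteSpace Y]

section Iterates

/-- Restarting the iteration: `z^{i+n}` is the `n`-th PDHG iterate started from `z^i` ("it follows
from Theorem 1 [applied from `z^{k−K}`]"). [cite: LuYang2022, §4 Thm 2 (proof, (13))] -/
theorem pdhgIter_add (K : X →L[ℝ] Y) (τ σ : ℝ) (jA : X → X) (jB : Y → Y) (z₀ : X × Y)
    (i n : ℕ) :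
    pdhgIter K τ σ jA jB z₀ (i + n) = pdhgIter K τ σ jA jB (pdhgIter K τ σ jA jB z₀ i) n := by
  induction n with
  | zero => rfl
  | succ n ih =>
    show pdhgStep K τ σ jA jB (pdhgIter K τ σ jA jB z₀ (i + n)) =
      pdhgStep K τ σ jA jB (pdhgIter K τ σ jA jB (pdhgIter K τ σ jA jB z₀ i) n)
    rw [ih]

/-- **The squared `M`-residual** `r_k = ‖z^k − z^{k+1}‖²_M` of the PDHG iterates — the squared
`M⁻¹`-norm of the certified element `M(z^k − z^{k+1}) ∈ F(z^{k+1})` of the KKT operator, hence an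
upper bound of the infimal sub-differential size `dist²_{M⁻¹}(0, F(z^{k+1}))`.
[cite: LuYang2022, §2 (4) and §3 (ω̃_{i+1} := P_s(z^i − z^{i+1}) ∈ F(z^{i+1}))] -/
noncomputable def msqResidual (K : X →L[ℝ] Y) (τ σ : ℝ) (jA : X → X) (jB : Y → Y) (z₀ : X × Y)
    (k : ℕ) : ℝ :=
  qM K τ σ (pdhgIter K τ σ jA jB z₀ k - pdhgIter K τ σ jA jB z₀ (k + 1))

/-- `r_k` written in the inner-product form of `PrimalDualHybridGradient.residual_le_div`.
[cite: LuYang2022, §3 Thm 1] -/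
theorem msqResidual_eq (K : X →L[ℝ] Y) (τ σ : ℝ) (jA : X → X) (jB : Y → Y) (z₀ : X × Y) (k : ℕ) :
    msqResidual K τ σ jA jB z₀ k =
      ⟪WithLp.toLp 2 (pdhgIter K τ σ jA jB z₀ k) - WithLp.toLp 2 (pdhgIter K τ σ jA jB z₀ (k + 1)),
        metricM K τ σ (WithLp.toLp 2 (pdhgIter K τ σ jA jB z₀ k) -
          WithLp.toLp 2 (pdhgIter K τ σ jA jB z₀ (k + 1)))⟫ := by
  rw [msqResidual, qM_eq, WithLp.toLp_sub]

/-- `r_k ≥ 0` (for `τσ‖K‖² ≤ 1`). [cite: LuYang2022, §3 Thm 1] -/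
theorem msqResidual_nonneg (K : X →L[ℝ] Y) {τ σ : ℝ} (hτ : 0 < τ) (hσ : 0 < σ)
    (hK : τ * σ * ‖K‖ ^ 2 ≤ 1) (jA : X → X) (jB : Y → Y) (z₀ : X × Y) (k : ℕ) :
    0 ≤ msqResidual K τ σ jA jB z₀ k :=
  qM_nonneg K hτ hσ hK _

/-- `r_k = ‖z^k − z^{k+1}‖_M²`. [cite: LuYang2022, §3 Thm 1] -/
theorem msqResidual_eq_normM_sq (K : X →L[ℝ] Y) {τ σ : ℝ} (hτ : 0 < τ) (hσ : 0 < σ)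
    (hK : τ * σ * ‖K‖ ^ 2 ≤ 1) (jA : X → X) (jB : Y → Y) (z₀ : X × Y) (k : ℕ) :
    msqResidual K τ σ jA jB z₀ k =
      normM K τ σ (pdhgIter K τ σ jA jB z₀ k - pdhgIter K τ σ jA jB z₀ (k + 1)) ^ 2 := by
  rw [normM_sq K hτ hσ hK, msqResidual]

/-- The residual after a shift is the residual of the restarted iteration:
`r_{i+n}(z⁰) = r_n(z^i)`. [cite: LuYang2022, §4 Thm 2 (proof, (13))] -/
theorem msqResidual_add (K : X →L[ℝ] Y) (τ σ : ℝ) (jA : X → X) (jB : Y → Y) (z₀ : X × Y)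
    (i n : ℕ) :
    msqResidual K τ σ jA jB z₀ (i + n) =
      msqResidual K τ σ jA jB (pdhgIter K τ σ jA jB z₀ i) n := by
  simp only [msqResidual, pdhgIter_add, Nat.add_assoc]

variable {K : X →L[ℝ] Y} {A : Set (X × X)} {B : Set (Y × Y)} {τ σ : ℝ} {jA : X → X} {jB : Y → Y}

/-- **The residual is non-increasing**: `r_{k+1} ≤ r_k` (the tree's `residual_antitone`;
[LY22, Prop 1] is the same monotonicity for the infimal size). [cite: LuYang2022, §2 Prop 1] -/
theorem msqResidual_antitone (hτ : 0 < τ) (hσ : 0 < σ) (hK : τ * σ * ‖K‖ ^ 2 ≤ 1)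
    (hA : IsMonotone A) (hB : IsMonotone B) (hjA : IsResolventMap τ A jA)
    (hjB : IsResolventMap σ B jB) (z₀ : X × Y) : Antitone (msqResidual K τ σ jA jB z₀) := by
  have h := residual_antitone K hτ hσ hK hA hB hjA hjB z₀
  intro m n hmn
  rw [msqResidual_eq, msqResidual_eq]
  exact h hmn

/-- **[LY22, Theorem 1] restarted at `z^i`**: for every saddle point `z*` and all `i`, `n`,
`r_{i+n} = ‖z^{i+n} − z^{i+n+1}‖²_M ≤ ‖z^i − z*‖²_M / (n + 1)`.
[cite: LuYang2022, §3 Thm 1; §4 Thm 2 (proof, (13))] -/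
theorem msqResidual_le_normM_sq_div (hτ : 0 < τ) (hσ : 0 < σ) (hK : τ * σ * ‖K‖ ^ 2 ≤ 1)
    (hA : IsMonotone A) (hB : IsMonotone B) (hjA : IsResolventMap τ A jA)
    (hjB : IsResolventMap σ B jB) {zs : X × Y} (hzs : WithLp.toLp 2 zs ∈ zer (kkt K A B))
    (z₀ : X × Y) (i n : ℕ) :
    msqResidual K τ σ jA jB z₀ (i + n) ≤
      normM K τ σ (pdhgIter K τ σ jA jB z₀ i - zs) ^ 2 / (n + 1) := by
  rw [msqResidual_add, msqResidual_eq, normM_sq K hτ hσ hK, qM_eq, WithLp.toLp_sub]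
  exact residual_le_div K hτ hσ hK hA hB hjA hjB hzs (pdhgIter K τ σ jA jB z₀ i) n

/-- Minimising over the saddle set: `r_{i+n} ≤ dist_M(z^i, Z*)² / (n + 1)` ("Taking the minimum
over `z* ∈ Z*` in the RHS of (13)"). [cite: LuYang2022, §4 Thm 2 (proof)] -/
theorem msqResidual_le_infDistM_sq_div (hτ : 0 < τ) (hσ : 0 < σ) (hK : τ * σ * ‖K‖ ^ 2 ≤ 1)
    (hA : IsMonotone A) (hB : IsMonotone B) (hjA : IsResolventMap τ A jA)
    (hjB : IsResolventMap σ B jB)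
    (hsad : ({w : X × Y | WithLp.toLp 2 w ∈ zer (kkt K A B)}).Nonempty) (z₀ : X × Y) (i n : ℕ) :
    msqResidual K τ σ jA jB z₀ (i + n) ≤
      infDistM K τ σ (pdhgIter K τ σ jA jB z₀ i) {w : X × Y | WithLp.toLp 2 w ∈ zer (kkt K A B)} ^ 2 /
        (n + 1) := by
  set r := msqResidual K τ σ jA jB z₀ (i + n) with hr
  have hr0 : 0 ≤ r := msqResidual_nonneg K hτ hσ hK jA jB z₀ (i + n)
  have hn : (0 : ℝ) < n + 1 := by positivity
  -- `√(r (n+1)) ≤ ‖z^i − z*‖_M` for every saddle point, hence `≤ dist_M(z^i, Z*)`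
  have h1 : Real.sqrt (r * (n + 1)) ≤
      infDistM K τ σ (pdhgIter K τ σ jA jB z₀ i) {w : X × Y | WithLp.toLp 2 w ∈ zer (kkt K A B)} := by
    refine le_infDistM K τ σ _ hsad fun w hw => ?_
    have h := msqResidual_le_normM_sq_div hτ hσ hK hA hB hjA hjB hw z₀ i n
    rw [← hr, le_div_iff₀ hn] at h
    calc Real.sqrt (r * (n + 1)) ≤ Real.sqrt (normM K τ σ (pdhgIter K τ σ jA jB z₀ i - w) ^ 2) :=
          Real.sqrt_le_sqrt h
      _ = normM K τ σ (pdhgIter K τ σ jA jB z₀ i - w) := Real.sqrt_sq (normM_nonneg K τ σ _)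
  have h2 : r * (n + 1) ≤
      infDistM K τ σ (pdhgIter K τ σ jA jB z₀ i) {w : X × Y | WithLp.toLp 2 w ∈ zer (kkt K A B)} ^ 2 := by
    have h3 := pow_le_pow_left₀ (Real.sqrt_nonneg _) h1 2
    rwa [Real.sq_sqrt (by positivity)] at h3
  rw [le_div_iff₀ hn]
  exact h2

/-- **One epoch** ([LY22, Thm 2], the induction step): under the sub-regularity hypothesis on the
certified element — `α² · dist_M(z^{i+1}, Z*)² ≤ r_i` for all `i` — every further `N + 1 ≥ e/α²`
iterations divide the residual by `e`: `r_{n+N+1} ≤ e⁻¹ · r_n`.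
[cite: LuYang2022, §4 Def 2 (9) and Thm 2 (proof)] -/
theorem msqResidual_contract (hτ : 0 < τ) (hσ : 0 < σ) (hK : τ * σ * ‖K‖ ^ 2 ≤ 1)
    (hA : IsMonotone A) (hB : IsMonotone B) (hjA : IsResolventMap τ A jA)
    (hjB : IsResolventMap σ B jB)
    (hsad : ({w : X × Y | WithLp.toLp 2 w ∈ zer (kkt K A B)}).Nonempty) (z₀ : X × Y) {α : ℝ}
    (hα : 0 < α)
    (hsub : ∀ i, α ^ 2 *
      infDistM K τ σ (pdhgIter K τ σ jA jB z₀ (i + 1)) {w : X × Y | WithLp.toLp 2 w ∈ zer (kkt K A B)}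
        ^ 2 ≤ msqResidual K τ σ jA jB z₀ i)
    {N : ℕ} (hN : Real.exp 1 / α ^ 2 ≤ (N : ℝ) + 1) (n : ℕ) :
    msqResidual K τ σ jA jB z₀ (n + 1 + N) ≤ Real.exp (-1) * msqResidual K τ σ jA jB z₀ n := by
  have hα2 : 0 < α ^ 2 := by positivity
  have hNpos : (0 : ℝ) < N + 1 := by positivity
  have h1 := msqResidual_le_infDistM_sq_div hτ hσ hK hA hB hjA hjB hsad z₀ (n + 1) N
  have h2 := hsub n
  -- `r_{n+1+N} ≤ d²/(N+1) ≤ r_n /(α² (N+1)) ≤ r_n / e`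
  have h3 : msqResidual K τ σ jA jB z₀ (n + 1 + N) ≤
      msqResidual K τ σ jA jB z₀ n / (α ^ 2 * ((N : ℝ) + 1)) := by
    rw [le_div_iff₀ (mul_pos hα2 hNpos)]
    rw [le_div_iff₀ hNpos] at h1
    nlinarith
  have h4 : Real.exp 1 ≤ α ^ 2 * ((N : ℝ) + 1) := by rwa [div_le_iff₀ hα2, mul_comm] at hN
  have hr0 : 0 ≤ msqResidual K τ σ jA jB z₀ n := msqResidual_nonneg K hτ hσ hK jA jB z₀ n
  calc msqResidual K τ σ jA jB z₀ (n + 1 + N)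
      ≤ msqResidual K τ σ jA jB z₀ n / (α ^ 2 * ((N : ℝ) + 1)) := h3
    _ ≤ msqResidual K τ σ jA jB z₀ n / Real.exp 1 :=
        div_le_div_of_nonneg_left hr0 (Real.exp_pos 1) h4
    _ = Real.exp (-1) * msqResidual K τ σ jA jB z₀ n := by
        rw [Real.exp_neg, div_eq_mul_inv, mul_comm]

/-- **[LY22, Theorem 2], epoch form**: with `K = N + 1 ≥ e/α²`,
`r_{n + cK} ≤ e^{−c} · r_n` for all `n`, `c`. [cite: LuYang2022, §4 Thm 2] -/
theorem msqResidual_le_exp_neg_mul (hτ : 0 < τ) (hσ : 0 < σ) (hK : τ * σ * ‖K‖ ^ 2 ≤ 1)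
    (hA : IsMonotone A) (hB : IsMonotone B) (hjA : IsResolventMap τ A jA)
    (hjB : IsResolventMap σ B jB)
    (hsad : ({w : X × Y | WithLp.toLp 2 w ∈ zer (kkt K A B)}).Nonempty) (z₀ : X × Y) {α : ℝ}
    (hα : 0 < α)
    (hsub : ∀ i, α ^ 2 *
      infDistM K τ σ (pdhgIter K τ σ jA jB z₀ (i + 1)) {w : X × Y | WithLp.toLp 2 w ∈ zer (kkt K A B)}
        ^ 2 ≤ msqResidual K τ σ jA jB z₀ i)
    {N : ℕ} (hN : Real.exp 1 / α ^ 2 ≤ (N : ℝ) + 1) (n c : ℕ) :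
    msqResidual K τ σ jA jB z₀ (n + c * (N + 1)) ≤
      Real.exp (-(c : ℝ)) * msqResidual K τ σ jA jB z₀ n := by
  induction c with
  | zero => simp
  | succ c ih =>
    have hstep := msqResidual_contract hτ hσ hK hA hB hjA hjB hsad z₀ hα hsub hN (n + c * (N + 1))
    have e1 : n + (c + 1) * (N + 1) = n + c * (N + 1) + 1 + N := by ring
    rw [e1]
    calc msqResidual K τ σ jA jB z₀ (n + c * (N + 1) + 1 + N)
        ≤ Real.exp (-1) * msqResidual K τ σ jA jB z₀ (n + c * (N + 1)) := hstep
      _ ≤ Real.exp (-1) * (Real.exp (-(c : ℝ)) * msqResidual K τ σ jA jB z₀ n) :=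
          mul_le_mul_of_nonneg_left ih (Real.exp_pos _).le
      _ = Real.exp (-((c + 1 : ℕ) : ℝ)) * msqResidual K τ σ jA jB z₀ n := by
          rw [← mul_assoc, ← Real.exp_add]; push_cast; ring_nf

/-- **[LY22, THEOREM 2] — linear decay of the PDHG residual under metric sub-regularity**, in the
printed shape: with `K = ⌈e/α²⌉` (any `N + 1 ≥ e/α²`), for every `k`,
`r_k ≤ exp(1 − k/K) · r_0` (the printed statement is for `k ≥ K` and the infimal size; here for all
`k`, on the certified residual, which dominates the infimal size). Hypotheses (real Hilbert spaces
`X`, `Y`): `A`, `B` monotone with resolvent maps; `τ, σ > 0`, `τσ‖K‖² ≤ 1`; a saddle point exists; and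
sub-regularity ON THE ITERATES for the certified element, `α² dist_M(z^{i+1}, Z*)² ≤ ‖z^i − z^{i+1}‖²_M`.
[cite: LuYang2022, §4 Thm 2 and Remark 4] -/
theorem msqResidual_le_exp (hτ : 0 < τ) (hσ : 0 < σ) (hK : τ * σ * ‖K‖ ^ 2 ≤ 1)
    (hA : IsMonotone A) (hB : IsMonotone B) (hjA : IsResolventMap τ A jA)
    (hjB : IsResolventMap σ B jB)
    (hsad : ({w : X × Y | WithLp.toLp 2 w ∈ zer (kkt K A B)}).Nonempty) (z₀ : X × Y) {α : ℝ}
    (hα : 0 < α)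
    (hsub : ∀ i, α ^ 2 *
      infDistM K τ σ (pdhgIter K τ σ jA jB z₀ (i + 1)) {w : X × Y | WithLp.toLp 2 w ∈ zer (kkt K A B)}
        ^ 2 ≤ msqResidual K τ σ jA jB z₀ i)
    {N : ℕ} (hN : Real.exp 1 / α ^ 2 ≤ (N : ℝ) + 1) (k : ℕ) :
    msqResidual K τ σ jA jB z₀ k ≤
      Real.exp (1 - (k : ℝ) / ((N : ℝ) + 1)) * msqResidual K τ σ jA jB z₀ 0 := by
  -- write `k = c (N+1) + j`, `0 ≤ j ≤ N`; monotonicity brings `r_k ≤ r_{c(N+1)} ≤ e^{-c} r_0`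
  set c := k / (N + 1) with hc
  set j := k % (N + 1) with hj
  have hk : k = c * (N + 1) + j := by rw [hc, hj, Nat.mul_comm, Nat.div_add_mod]
  have hjlt : j < N + 1 := Nat.mod_lt _ (Nat.succ_pos N)
  have hmono := msqResidual_antitone hτ hσ hK hA hB hjA hjB z₀
  have h1 : msqResidual K τ σ jA jB z₀ k ≤ msqResidual K τ σ jA jB z₀ (0 + c * (N + 1)) := by
    rw [zero_add]; exact hmono (by rw [hk]; exact Nat.le_add_right _ _)
  have h2 := msqResidual_le_exp_neg_mul hτ hσ hK hA hB hjA hjB hsad z₀ hα hsub hN 0 c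
  have hr0 : 0 ≤ msqResidual K τ σ jA jB z₀ 0 := msqResidual_nonneg K hτ hσ hK jA jB z₀ 0
  -- `e^{-c} ≤ exp(1 − k/(N+1))` since `k/(N+1) ≤ c + 1`, i.e. `k < (c+1)(N+1)`
  have h3 : Real.exp (-(c : ℝ)) ≤ Real.exp (1 - (k : ℝ) / ((N : ℝ) + 1)) := by
    refine Real.exp_le_exp.2 ?_
    have hNpos : (0 : ℝ) < N + 1 := by positivity
    have hk' : (k : ℝ) = c * (N + 1) + j := by rw [hk]; push_cast; ring
    have hj' : (j : ℝ) ≤ N := by exact_mod_cast Nat.lt_succ_iff.mp hjlt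
    have h4 : (k : ℝ) / ((N : ℝ) + 1) ≤ c + 1 := by
      rw [div_le_iff₀ hNpos, hk']
      nlinarith
    linarith
  calc msqResidual K τ σ jA jB z₀ k ≤ msqResidual K τ σ jA jB z₀ (0 + c * (N + 1)) := h1
    _ ≤ Real.exp (-(c : ℝ)) * msqResidual K τ σ jA jB z₀ 0 := h2
    _ ≤ Real.exp (1 - (k : ℝ) / ((N : ℝ) + 1)) * msqResidual K τ σ jA jB z₀ 0 :=
        mul_le_mul_of_nonneg_right h3 hr0

end Iterates

end Literature.Analysis.Convex.PDHGResidualMetricSubregularity
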